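import Mathlib
import HarnessLib
import HarnessLib.Audit
import Summits.NavierStokesRegularity.Statement
import Literature.Analysis.FunctionSpaces.TorusFluidGlue
import Summits.NavierStokesRegularity.NavierStokesRegularity.Theorems.NavierStokesBreakdownPeriodicPressurePeriodic
import HarnessLib.Audit.Status.Attr

/-!
Route: ForcedAmplifier

# Route ForcedAmplifier — The negative board's root node — Clay (D, erratum reading) follows from
unbounded forced H1 amplification plus Tao's qualitative-to-quantitative door

ROOT DECOMPOSITION CELL decomp-ns (D-0178/D-0179, RESIDUAL MODE · BLOCKER FIRST), node N31 «THE
AMPLIFIER» (lens-4 g20, critic CLEARED modest 2026-08-30T16:04:13Z row 194; supports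
Bridge/Exactness/ViscosityNormalisation PROVED IN LENS g25, critic CLEARED (KERNEL) rows 251/252).
FIRST NODE OF THE CELL ON THE NEGATIVE BOARD: the target is the ERRATUM LEAF of Clay (D),
`Summit.NavierStokesRegularity.NavierStokesRegularity.NavierStokesBreakdownPeriodicPressurePeriodic`
(D♯; BOARD RULE D-0052, `closes_target: D-errata`), not Clay (A). Write SFR ν for Tao 2013
Conjecture 1.8 in torus form (every smooth 1-periodic forced datum (u₀, f, T), f jointly smooth on
[0,∞) × 𝕋³, has a classical solution of NS_ν(f) on [0,T] × 𝕋³ with TORUS — i.e. periodic, i.e.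
normalised — pressure) and APB ν for his Conjecture 1.10 at period L = 1 (an a-priori bound
sup_[0,T] ‖u‖²_H¹ ≤ F(A, T₀) over smooth forced episodes with T ≤ T₀, ‖u(0)‖²_H¹ ≤ A, sup_t
‖f(t)‖²_H¹ ≤ A; ‖v‖²_H¹ := 2·Torus.kineticEnergy v + Torus.gradNormSq v). The erratum leaf is
EXACTLY «∀ ν > 0, ¬SFR ν» (support Bridge + aside Exactness, both PROVED in the lens: lift/descend
𝕋³ ↔ ℝ³-periodic, smooth time cut-off of the force, forward uniqueness + horizon patching). It
suffices to show X = AMP ∧ QuantitativeGap: AMP := ∀ ν > 0, ¬APB ν (the EXTREMAL face — smooth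
forced periodic episodes of bounded H¹ data size and bounded horizon reach arbitrarily large
‖u(t)‖²_H¹; ⟺ ¬Conj 1.10 ⟺ ¬Conj 1.9 by Tao 2013 Thm 1.20(i); NO singular object is asked for) and
QuantitativeGap := ∀ ν > 0, SFR ν → APB ν (the DOOR — qualitative regularity for C^∞ forcing ⟹
quantitative bounds in the rough size H¹ × L^∞_t H¹_x; the converse of Thm 1.20(ii)∘(i) that Tao
writes he was «unable to obtain in the inhomogeneous case», whose homogeneous twin is a theorem —
aside QuantitativeGapHomogeneous). `closes (hAMP) (hQ) (hB : Bridge)` is pure logic (lens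
`ForcedAmplifier.closes`, re-proved on the inlined items in the writer Sketch). Exactness chain
(lens, kernel): D♯ ⟹ ¬SFR (Exactness, PROVED) ⟹ AMP (BlowupAlternative, aside, classical forced H¹
blow-up alternative — needs one missing tree theorem) and D♯ ⟹ QuantitativeGap vacuously
(`quantitativeGap_of_target'`, PROVED) — so D♯ ⟺ AMP ∧ QuantitativeGap modulo classical supports,
and the residual AMP lies below EVERY negative Clay target (¬(B) ⟹ (D) ⟹ D♯ ⟹ AMP; (C) ⟹ AMP by Tao
Thm 1.20 (iv),(iii),(i)). All items are DEF-FREE inlinings of the lens vocabulary (T3 = UnitAddTorus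
(Fin 3), h1Sq, IsEpisode, Amplification, AprioriH1Bound, SmoothForcedRegular, BreakdownAt = the
ν-slice of D♯ verbatim), each certified `Iff.rfl` against the lens decl (writer Sketch, rc 0). Lens
files: HOME/decomp-ns-lens-4/ForcedAmplifier.lean sha256
12afe75c7563a44d6b20fe3f3a07260c5a7b73aefc5526026866e08d3aaec3a2 (node), ForcedAmplifierBridge.lean
sha256 c174d19faac1971dc7c2735e7eef1e41e25f8d46b9cb1663c9225c4be555b553 (supports proved); memos
NODE-g20.md, NODE-g25.md; census instrument T-amp (NODE-g20 §6; predictions P1–P4 registered before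
numbers).
Lean: `∀ ν : ℝ, 0 < ν → ∃ A T₀ : ℝ, ∀ M : ℝ, ∃ (T : ℝ) (f u : ℝ → UnitAddTorus (Fin 3) →
EuclideanSpace ℝ (Fin 3)) (p : ℝ → UnitAddTorus (Fin 3) → ℝ), (0 < T ∧
Literature.Analysis.FunctionSpaces.Torus.IsClassicalNSSolutionOn (Set.Icc 0 T) ν f u p ∧
Literature.Analysis.FunctionSpaces.Torus.IsSmoothSpaceTimeOn (Set.Icc 0 T) f) ∧ T ≤ T₀ ∧ 2 *
Literature.Analysis.FunctionSpaces.Torus.kineticEnergy (u 0) +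
Literature.Analysis.FunctionSpaces.Torus.gradNormSq (u 0) ≤ A ∧ (∀ t ∈ Set.Icc 0 T, 2 *
Literature.Analysis.FunctionSpaces.Torus.kineticEnergy (f t) +
Literature.Analysis.FunctionSpaces.Torus.gradNormSq (f t) ≤ A) ∧ ∃ t ∈ Set.Icc 0 T, M < 2 *
Literature.Analysis.FunctionSpaces.Torus.kineticEnergy (u t) +
Literature.Analysis.FunctionSpaces.Torus.gradNormSq (u t) ∧ (∀ ν : ℝ, 0 < ν → (∀ T : ℝ, 0 < T → ∀ u₀
: UnitAddTorus (Fin 3) → EuclideanSpace ℝ (Fin 3), Literature.Analysis.FunctionSpaces.Torus.IsSmooth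
u₀ → Literature.Analysis.FunctionSpaces.Torus.IsDivFree u₀ → ∀ f : ℝ → UnitAddTorus (Fin 3) →
EuclideanSpace ℝ (Fin 3), Literature.Analysis.FunctionSpaces.Torus.IsSmoothSpaceTimeOn (Set.Ici 0) f
→ ∃ (u : ℝ → UnitAddTorus (Fin 3) → EuclideanSpace ℝ (Fin 3)) (p : ℝ → UnitAddTorus (Fin 3) → ℝ),
Literature.Analysis.FunctionSpaces.Torus.IsClassicalNSSolutionOn (Set.Icc 0 T) ν f u p ∧ u 0 = u₀) →
∀ A T₀ : ℝ, ∃ M : ℝ, ∀ (T : ℝ) (f u : ℝ → UnitAddTorus (Fin 3) → EuclideanSpace ℝ (Fin 3)) (p : ℝ →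
UnitAddTorus (Fin 3) → ℝ), (0 < T ∧ Literature.Analysis.FunctionSpaces.Torus.IsClassicalNSSolutionOn
(Set.Icc 0 T) ν f u p ∧ Literature.Analysis.FunctionSpaces.Torus.IsSmoothSpaceTimeOn (Set.Icc 0 T)
f) → T ≤ T₀ → 2 * Literature.Analysis.FunctionSpaces.Torus.kineticEnergy (u 0) +
Literature.Analysis.FunctionSpaces.Torus.gradNormSq (u 0) ≤ A → (∀ t ∈ Set.Icc 0 T, 2 *
Literature.Analysis.FunctionSpaces.Torus.kineticEnergy (f t) +
Literature.Analysis.FunctionSpaces.Torus.gradNormSq (f t) ≤ A) → ∀ t ∈ Set.Icc 0 T, 2 *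
Literature.Analysis.FunctionSpaces.Torus.kineticEnergy (u t) +
Literature.Analysis.FunctionSpaces.Torus.gradNormSq (u t) ≤ M)`

## Assembly
Pure logic over the binders (writer Sketch `closes`, = lens `ForcedAmplifier.closes` with
`amplification_iff_not_aprioriH1Bound` inlined): given ν > 0, apply Bridge; a putative SFR ν gives
APB ν by QuantitativeGap, i.e. a bound M = F(A, T₀) for the A, T₀ of AMP at ν; AMP's episode
exceeding M contradicts it. The conclusion is the erratum leaf D♯ BY NAME (closes_target D-errata,
BOARD RULE D-0052). Every binder (hAMP, hQ, hB) is consumed; cone = 2 open cruxes + 1 proved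
support.

CLOSES_TARGET: closes Clay (D-errata): Summit.NavierStokesRegularity.NavierStokesRegularity.NavierStokesBreakdownPeriodicPressurePeriodic (board rule D-0052) — the deciding theorem of this route concludes that registered leaf instead of the Statement decl `NavierStokesRegularity` (class clay: a kernel-checked proof closes the summit on the programme's board).

Rationale: WHY THIS LINE. Mechanism: Tao's localisation/compactness dichotomy for the periodic forced problem
(Tao2013 = arXiv:1108.1165, Conj. 1.8/1.9/1.10, Thm 1.20, Rem. 1.11; Tao2009 = arXiv:0710.1604 Thm
1.4) typed as a decomposition of the CHEAPEST negative Clay leaf: ¬SFR splits along Thm 1.20 into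
the extremal face AMP (an inequality failure sup Φ(A,T₀) = ∞ over FAMILIES of global smooth
episodes) and the door QGAP (force-smoothing: qualitative-for-C^∞ ⟹ quantitative-in-rough-size).
Imported from the optimal-enstrophy-growth literature (LuDoering2008 doi:10.1512/iumj.2008.57.3716;
AyalaProtas2017 doi:10.1017/jfm.2017.136; KangYunProtas2020 arXiv:1909.00041: unforced maximal
amplification finite ∝ ℰ₀^(3/2)) is the census currency for AMP (instrument T-amp). What the line
does that the 30 born decomp-ns routes do not: all of them decompose Clay (A); this is the first
node on the negative board, its residual needs NO singular object (a sequence of smooth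
global-on-[0,T] forced flows with an unbounded H¹ transient suffices) — strictly less than
`Theses/PalasekTowerBreakdown.lean` (an actual blow-up on ℝ³, concludes (C)) and than
`Theses/RobustBlowupPortability.lean` (ports an unforced TORUS blow-up to ℝ³) — and its door is
FORCE-SMOOTHING, not torus→ℝ³ portability and not a Liouville theorem. Why each piece is strictly
weaker than D♯ (critic rows 194/251/252): AMP ⟸ D♯ via Exactness (PROVED) + BlowupAlternative
(classical, aside), while AMP ⟹ D♯ is exactly QGAP∘Bridge, open in print (AMP is consistent with
SFR: the «rough-only blow-up» world); QGAP ⟸ D♯ vacuously (PROVED `quantitativeGap_of_target'`) and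
QGAP holds in the (B)-world iff Conj 1.10 does, so it cannot imply D♯. Both cruxes are KNOWN-OPEN
statements of Tao 2013 (critic: «ONE EQUIV layer = Tao's diagram typed; both KNOWN-OPEN residuals,
no prover allocation» — the first prover targets are the supports: Bridge port (proved in lens),
then BlowupAlternative after the missing time-dependent-force H¹ continuation theorem).

RANKED CRUXES. #2 AMP (crux) — DECLARED RESIDUAL · tag WEAKER(evidence: D♯ ⟹ AMP via Exactness
(proved) + BlowupAlternative (classical); converse = QGAP∘Bridge open in print) · leaf IDEA-NEEDED
(no subcritical forced-amplification engine; first idea: finite forced towers of unbounded height at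
bounded H¹ cost, NODE-g20 §14) + INSTRUMENTABLE (census dial T-amp, NODE-g20 §6). For every ν > 0
there are a data size A and a horizon T₀ such that smooth forced 1-periodic episodes (classical
solution of NS_ν(f) on [0,T] × 𝕋³ with torus pressure, f jointly smooth on [0,T] × 𝕋³) with T ≤ T₀,
‖u(0)‖²_H¹ ≤ A, sup_t ‖f(t)‖²_H¹ ≤ A reach ARBITRARILY LARGE ‖u(t)‖²_H¹ — the negation of Tao 2013
Conj. 1.10 (L = 1) at every viscosity (⟺ at ν = 1 by the aside ViscosityNormalisation, PROVED in
lens). [difficulty: open-problem] (why it might fail: false iff Tao's Conj 1.10 holds at one ν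
(which yields Clay (B)); numerically unforced maximal enstrophy amplification is finite ∝ ℰ₀^(3/2)
(Kang–Yun–Protas 2020) and no forced subcritical engine is known.) [arXiv:1108.1165,
arXiv:1909.00041, doi:10.1512/iumj.2008.57.3716, doi:10.1017/jfm.2017.136]
#3 QuantitativeGap (crux) — THE DOOR · tag WEAKER(evidence, CERTIFIED: D♯ ⟹ QGAP vacuously, lens
`quantitativeGap_of_target'`; QGAP holds in the (B)-world iff Conj 1.10) · leaf IDEA-NEEDED /
UNDECIDED(test: T-amp prediction P1 «UV waste») · BARRIER named (NormBallNotCompact: the hypothesis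
class C^∞ is not closed under the weak-* limits carrying bounded H¹ × L^∞_t H¹_x families; parabolic
smoothing regularises u, never f). For every ν > 0: Tao's Conj. 1.8 in torus form (SFR ν) implies
his Conj. 1.10 (APB ν) — qualitative regularity for smooth periodic forced data implies the
quantitative a-priori H¹ bound in the rough data size. [difficulty: open-problem] (why it might
fail: a «rough-only blow-up» (¬Conj 1.9 with Conj 1.8 true) contradicts no known theorem;
bang-bang-in-time / lattice-in-frequency forcing is a strictly larger design space than C^∞
forcing.) [arXiv:1108.1165, arXiv:0710.1604, arXiv:2101.08586]
#9 Bridge (support) — IN CONE (binder hB of `closes`) · tag COSTUME(cite: board translation 𝕋³ ↔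
ℝ³-periodic) · PROVED IN LENS (`ForcedAmplifierBridge.bridge_holds`, critic rows 251/252; writer
lands the def-free port as Theorems/ForcedAmplifierBridge.lean, FIRST LANDING). For every ν > 0, a
failure of SFR ν yields the ν-slice of D♯: lift u₀ and f to ℤ³-periodic fields on ℝ³ (`Torus.lift`),
cut the force off smoothly in time after the failing horizon T (χ_T = Real.smoothTransition (T+1−t);
compact time support ⟹ HasRapidTimeDecay), and descend any putative smooth solution with periodic
u(t), p(t) to a classical torus solution on [0,T] (`IsClassicalNSSolutionOn.to_torus_holds`,
`Torus.lift_descend_holds`). [difficulty: provable-now] [FeffermanClay2006, arXiv:1108.1165]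
#9 Exactness (support) — ASIDE (certificate; not in cone) · tag COSTUME(cite) · PROVED IN LENS
(`ForcedAmplifierBridge.exactness_holds`). For every ν > 0 a D♯ datum refutes SFR ν: descend (U₀, F)
to the torus; SFR gives classical solutions on every slab [0,T]; forward uniqueness patches them to
[0,∞) (`Torus.IsClassicalNSSolutionOn.exists_Ici_iff_forall_Icc`); the lift is a smooth solution on
ℝ³ × [0,∞) with periodic u and p — contradicting D♯. With Bridge: D♯ ⟺ ∀ ν > 0, ¬SFR ν (lens
`target_iff_not_smoothForcedRegular'`, unconditional). [difficulty: provable-now] [arXiv:1108.1165,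
RobinsonRodrigoSadowskiCUP2016, ConstantinFoias1988]
#9 BlowupAlternative (support) — ASIDE (exactness certificate making AMP's WEAKER tag unconditional;
not in cone) · tag COSTUME(cite: forced H¹ blow-up alternative, Constantin–Foias Ch. 10; Tao 2013
Thm 5.1/Lem 5.2) · leaf ATTACKABLE after ONE missing tree theorem (NODE-g25 §1: the
time-dependent-force twin of `Torus.classicalNS_forced_continuation_of_gradNormSq_le` — a classical
solution of NS_ν(f), f jointly smooth, on [0,T) with ‖u(t)‖_H¹ ≤ E₁ continues past T; size L). For
every ν > 0, ¬SFR ν ⟹ Amplification ν: the maximal solution from the failing datum has unbounded H¹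
norm before T, and its restrictions to [0,Tₙ], Tₙ ↑ T*, are episodes of one data size with unbounded
peaks. [difficulty: L] [ConstantinFoias1988, arXiv:1108.1165, RobinsonRodrigoSadowskiCUP2016]
#9 ViscosityNormalisation (support) — ASIDE (not in cone) · tag COSTUME(cite: scaling, Tao 2013 Rem.
1.11) · PROVED IN LENS (`ForcedAmplifierBridge.viscosityNormalisation_holds`: (u,p,f)(t,x) ↦ (ν
u(νt,x), ν² p(νt,x), ν² f(νt,x)) at fixed period via
`Torus.IsClassicalNSSolutionOn.rescale_translate`; sizes ×ν² / ×ν⁴, horizon ÷ν). Amplification at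
unit viscosity implies AMP — the residual may be read AT ν = 1 (lens `closes_unitViscosity'`).
[difficulty: provable-now] [arXiv:1108.1165]
#9 QuantitativeGapHomogeneous (support) — ASIDE — the BC5 WITNESS OF WEAKNESS for QuantitativeGap
(not in cone) · tag COSTUME(cite: KNOWN THEOREM, Tao 2009 arXiv:0710.1604 Thm 1.4 (i)⟺(iii); Tao
2013 Thm 1.20(i),(ii) at f ≡ 0) · leaf ATTACKABLE (formalise-by-citation). In the UNFORCED model the
door is decided: qualitative periodic regularity (Conj 1.6 torus form at ν) implies the a-priori
homogeneous H¹ bound (Conj 1.16 at ν) — while the summit analogue there, Clay (B), is open. Differs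
from QuantitativeGap in exactly one clause: the weak-* limit FORCE is not smooth. [difficulty: M]
[arXiv:0710.1604, arXiv:1108.1165]

TWO-LAYER PLAN. Foreseen (not filed): AMP ⇐ «finite forced towers of unbounded height at bounded H¹
cost» (NODE-g20 §14: for each M a FINITE Palasek-type tower, finitely many hand-overs reaching
‖u‖²_H¹ > M, data cost bounded uniformly in M, periodised, forcing allowed throughout — heredity for
finitely many levels with uniform constants, minus the singular-limit step of
`PalasekTowerBreakdown`); QuantitativeGap ⇐ a force-smoothing lemma (near-extremal forcings waste
UV, T-amp P1) or a structure theorem for extremal forcing. BlowupAlternative ⇐ the missing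
time-dependent-force H¹ continuation theorem (Literature) + `Torus.classicalNS_exhaust_Ico` +
`glue_restart` + `velocity_unique`.

KILL CRITERIA. (k1) a proof of APB ν for one ν > 0 (= Conj 1.10) refutes AMP and closes the POSITIVE
board ((B) follows) — close --reason refuted:AMP, gloriously; (k2) a rough-only blow-up theorem
(¬Conj 1.9 together with SFR) refutes QuantitativeGap — route retired, AMP banked TRUE; (k3) a proof
that QuantitativeGap ⟹ (B)-type regularity (door summit-hard on the positive side) demotes the node
to a dictionary (close --reason exhausted with census). A proof of (A), (B) or (C) elsewhere moots
the route (board closed).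

NOT DECOMPOSED YET. AMP is not decomposed (IDEA-NEEDED; the finite-forced-tower idea of NODE-g20 §14
is a card-level first attack, not a typed split); QuantitativeGap is not decomposed (every
compactness / truncation / regularity-ladder / drift / Baire variant weighed in NODE-g20 §4 dies on
the one wall: no modulus for the smooth truncated problem under qualitative SFR); BlowupAlternative
waits for one Literature theorem. Constants (A ↦ 4A between Tao's ℋ¹ and the two separate bounds)
are immaterial and not itemised.

CHEAPEST FALSIFIER. A published a-priori H¹ bound for forced periodic Navier–Stokes at large data
(would kill AMP and settle (B)): none — searched 2026-08-30 corpus fts+vec «a priori bound periodic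
Navier-Stokes forcing quantitative qualitative» and galaxy «Localisation and compactness
properties|normalised pressure» (hits: Tao 2013 itself; Palasek arXiv:2101.08586 — critical,
homogeneous; Lemarié-Rieusset 2016 p.124 — pressure only). In Lean: the lens collapse batteries
(bc/Probe.lean of g20: neither crux gives D♯ cheaply, neither is provable/refutable cheaply, 7/7
FAIL) and the writer's BC7 probes (below).

NUMBERS. Unforced maximal enstrophy amplification: max_T ℰ(T) ≈ C·ℰ₀^(3/2) over the computed range
(Kang–Yun–Protas 2020, arXiv:1909.00041 p.2/p.14; Lu–Doering 2008 instantaneous bound dℰ/dt ≤ c·ℰ³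
sharp, Ayala–Protas 2017). Linear (Stokes) gain at bounded forcing: ≤ A(1+T₀). Census dial T-amp
(NODE-g20 §6): Φ_N(A; T₀ = 1, ν = 1), predictions P1 «UV waste», P2 «3/2 law persists», P3
«bang-bang», P4 «forcing premium O(1)» registered before numbers (C-DIAL).

DEFINITION REQUESTS. None (all items over accepted tree declarations: Torus.IsClassicalNSSolutionOn,
Torus.IsSmoothSpaceTimeOn, Torus.kineticEnergy, Torus.gradNormSq, Torus.IsSmooth, Torus.IsDivFree,
NSWave0.IsDivFree, IsLatticePeriodic, IsSmoothOnHalfSpace, HasRapidTimeDecay,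
IsNavierStokesSolution). Wanted Literature theorem (not a definition): the time-dependent-force H¹
continuation criterion on 𝕋³ (RRS 2016 Thm 6.8 with f ∈ L²_t L²_x; Constantin–Foias Ch. 10) —
unlocks BlowupAlternative.

Novelty: Searches (2026-08-30, lens-4 g20 §11/§13, both corpora, labels kept): `lit search --hybrid "a priori
bound periodic Navier-Stokes forcing L^infty_t H^1 quantitative qualitative"` → textbooks only
[corpus: book:robinson2016 p.19/117; book:lemarie-rieusset2016 p.777–802, cites Tao 2013 only at
p.124]; `lit vsearch "<QuantitativeGap in prose>"` → no specific hit; `lit galaxy search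
"Localisation and compactness properties" --star all` → [galaxy:pdf:3327933239271363760] Palasek
arXiv:2101.08586 (critical, homogeneous), [galaxy:panama:505491880935428] Lemarié-Rieusset 2nd ed.;
`lit galaxy search "normalised pressure|normalized pressure condition"` → noise; `lit search
"maximum amplification enstrophy Protas" --source all` → [corpus: paper-arxiv-1909.00041]
Kang–Yun–Protas 2020, doi:10.1017/jfm.2017.136, doi:10.1512/iumj.2008.57.3716; no hits for
"Conjecture 1.8 implies Conjecture 1.10 / inhomogeneous quantitative formulation" in corpus
(fts+vec) and galaxy. Tree: `rg 'AprioriH1Bound|Conjecture 1.10' lean/` → TaoH1APrioriForced*.lean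
are ℝ³ local-theory H¹ facts, not Conj 1.10; no Theses file on the negative board with an
amplification residual (forest TREE.md v0.9: 30 born decomp-ns routes, all on (A); legacy negative
theses PalasekTowerBreakdown (C), RobustBlowupPortability, Blowup (closed refuted),
TaoLadderRungTwoBreak, CertifiedBlowup).
Nearest prior art found: arXiv:1108.1165 (Tao 2013) itself — the dichotomy Conj 1.8 / 1.9 / 1.10 and
Thm 1.20 are his; [corpus: paper-arxiv-11  [refs: 10.1017/jfm.2017.136, 10.1512/iumj.2008.57.3716, 2101.08586, 1108.1165, book:robinson2016, book:lemarie-rieusset2016, paper-arxiv-1909.00041, doi:10.1017/jfm.2017.136, doi:10.1512/iumj.2008.57.3716, paper-arxiv-1108.1165]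

Barriers (technique_class: negative-board decomposition, compactness, amplification): - technique_class: negative-board decomposition, compactness, amplification
- Literature.Barriers.NavierStokesRegularity.SmallDataGlobalRegularity: AMP outside — it carries its
amplitude threshold explicitly (∃A; small A excluded by local well-posedness, Tao Rem 1.11).
- Literature.Barriers.NavierStokesRegularity.PalasekTowerKelvinCeiling: AMP outside — no winding-one
tower, no singularity, no amplitude exponent is posited; a tower WOULD be one realisation of AMP and
then the ceiling applies to that realisation only (as to the parent PalasekTowerBreakdown).
- Literature.Barriers.NavierStokesRegularity.RobustCounterObstruction: AMP outside unless realised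
by a fluid computer.
- Literature.Barriers.NavierStokesRegularity.EnstrophyODENoGlobalClosure: neutral — the cubic law
dℰ/dt ≤ cℰ³ can neither prove APB (kill AMP) nor produce AMP witnesses (real flows need not saturate
Lu–Doering for O(1) time, KYP 2020).
- Literature.Barriers.NavierStokesRegularity.CriticalDataArbitraryNormGrowth: it does, for AMP —
growth theorems exist only for data bounded in CRITICAL or small in SUPERCRITICAL spaces (Palasek
2025: ‖u⁰‖ in B^(-1)_(∞,1) ≤ 10⁵ with H¹-unbounded data); AMP asks H¹-BOUNDED data: requires-beating
— the bet is forcing-assisted subcritical amplification in bounded time; AMP is the DECLARED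
RESIDUAL (BC9 ceiling = this barrier family).
- Literature.Barriers.NavierStokesRegularity.CriticalBesovNormInflation: same placement as
CriticalDataArbitraryNormGrowth (norm inflation lives

sub-problem: NavierStokesRegularity · status: draft · opened planner-decomp-ns-writer-1-g8-0 2026-08-30T19:42:39Z · rev 1 · ledger route-NavierStokesRegularity-ForcedAmplifier
GENERATED by the gate from the ledger (D-0016/17). Provers cite these decls: `theorem foo : Summit.NavierStokesRegularity.NavierStokesRegularity.Theses.ForcedAmplifier.<Decl> := …` in Summits/NavierStokesRegularity/NavierStokesRegularity/Theorems/<Name>.lean.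
-/

namespace Summit.NavierStokesRegularity.NavierStokesRegularity.Theses.ForcedAmplifier

open scoped BigOperators Topology Manifold Classical MeasureTheory ProbabilityTheory Matrix InnerProductSpace ComplexConjugate ContinuousMap
open Filter Set Function TopologicalSpace MeasureTheory

attribute [summit_statement] _root_.NavierStokesRegularity
attribute [summit_statement] _root_.Summit.NavierStokesRegularity.NavierStokesRegularity.NavierStokesBreakdownPeriodicPressurePeriodic

open Literature.NS

/-- item stmt-NavierStokesRegularity-28101 · crux · rank 2 · open · by planner
why it might fail: false iff Tao's Conj 1.10 holds at one ν (which yields Clay (B)); numerically unforced maximal enstrophy amplification is finite ∝ ℰ₀^(3/2) (Kang–Yun–Protas 2020) and no forced subcritical engine is known.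
sources: arXiv:1108.1165, arXiv:1909.00041, doi:10.1512/iumj.2008.57.3716, doi:10.1017/jfm.2017.136
[crux] DECLARED RESIDUAL · tag WEAKER(evidence: D♯ ⟹ AMP via Exactness (proved) + BlowupAlternative
(classical); converse = QGAP∘Bridge open in print) · leaf IDEA-NEEDED (no subcritical
forced-amplification engine; first idea: finite forced towers of unbounded height at bounded H¹
cost, NODE-g20 §14) + INSTRUMENTABLE (census dial T-amp, NODE-g20 §6). For every ν > 0 there are a
data size A and a horizon T₀ such that smooth forced 1-periodic episodes (classical solution of
NS_ν(f) on [0,T] × 𝕋³ with torus pressure, f jointly smooth on [0,T] × 𝕋³) with T ≤ T₀, ‖u(0)‖²_H¹ ≤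
A, sup_t ‖f(t)‖²_H¹ ≤ A reach ARBITRARILY LARGE ‖u(t)‖²_H¹ — the negation of Tao 2013 Conj. 1.10 (L
= 1) at every viscosity (⟺ at ν = 1 by the aside ViscosityNormalisation, PROVED in lens).
[difficulty: open-problem] -/
@[route_item "route-NavierStokesRegularity-ForcedAmplifier", crux]
def AMP : Prop :=
  ∀ ν : ℝ, 0 < ν → ∃ A T₀ : ℝ, ∀ M : ℝ, ∃ (T : ℝ) (f u : ℝ → UnitAddTorus (Fin 3) → EuclideanSpace ℝ (Fin 3)) (p : ℝ → UnitAddTorus (Fin 3) → ℝ), (0 < T ∧ Literature.Analysis.FunctionSpaces.Torus.IsClassicalNSSolutionOn (Set.Icc 0 T) ν f u p ∧ Literature.Analysis.FunctionSpaces.Torus.IsSmoothSpaceTimeOn (Set.Icc 0 T) f) ∧ T ≤ T₀ ∧ 2 * Literature.Analysis.FunctionSpaces.Torus.kineticEnergy (u 0) + Literature.Analysis.FunctionSpaces.Torus.gradNormSq (u 0) ≤ A ∧ (∀ t ∈ Set.Icc 0 T, 2 * Literature.Analysis.FunctionSpaces.Torus.kineticEnergy (f t) + Literature.Analysis.FunctionSpaces.Torus.gradNormSq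 (f t) ≤ A) ∧ ∃ t ∈ Set.Icc 0 T, M < 2 * Literature.Analysis.FunctionSpaces.Torus.kineticEnergy (u t) + Literature.Analysis.FunctionSpaces.Torus.gradNormSq (u t)

/-- item stmt-NavierStokesRegularity-28102 · crux · rank 3 · open · by planner
why it might fail: a «rough-only blow-up» (¬Conj 1.9 with Conj 1.8 true) contradicts no known theorem; bang-bang-in-time / lattice-in-frequency forcing is a strictly larger design space than C^∞ forcing.
sources: arXiv:1108.1165, arXiv:0710.1604, arXiv:2101.08586
[crux] THE DOOR · tag WEAKER(evidence, CERTIFIED: D♯ ⟹ QGAP vacuously, lens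
`quantitativeGap_of_target'`; QGAP holds in the (B)-world iff Conj 1.10) · leaf IDEA-NEEDED /
UNDECIDED(test: T-amp prediction P1 «UV waste») · BARRIER named (NormBallNotCompact: the hypothesis
class C^∞ is not closed under the weak-* limits carrying bounded H¹ × L^∞_t H¹_x families; parabolic
smoothing regularises u, never f). For every ν > 0: Tao's Conj. 1.8 in torus form (SFR ν) implies
his Conj. 1.10 (APB ν) — qualitative regularity for smooth periodic forced data implies the
quantitative a-priori H¹ bound in the rough data size. [difficulty: open-problem] -/
@[route_item "route-NavierStokesRegularity-ForcedAmplifier", crux]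
def QuantitativeGap : Prop :=
  ∀ ν : ℝ, 0 < ν → (∀ T : ℝ, 0 < T → ∀ u₀ : UnitAddTorus (Fin 3) → EuclideanSpace ℝ (Fin 3), Literature.Analysis.FunctionSpaces.Torus.IsSmooth u₀ → Literature.Analysis.FunctionSpaces.Torus.IsDivFree u₀ → ∀ f : ℝ → UnitAddTorus (Fin 3) → EuclideanSpace ℝ (Fin 3), Literature.Analysis.FunctionSpaces.Torus.IsSmoothSpaceTimeOn (Set.Ici 0) f → ∃ (u : ℝ → UnitAddTorus (Fin 3) → EuclideanSpace ℝ (Fin 3)) (p : ℝ → UnitAddTorus (Fin 3) → ℝ), Literature.Analysis.FunctionSpaces.Torus.IsClassicalNSSolutionOn (Set.Icc 0 T) ν f u p ∧ u 0 = u₀) → ∀ A T₀ : ℝ, ∃ M : ℝ, ∀ (T : ℝ) (f u : ℝ → UnitAddTorus (Fin 3) → EuclideanSpace ℝ (Fin 3)) (p : ℝ → UnitAddTorus (Fin 3) → ℝ), (0 < T ∧ Literature.Analysis.FunctionSpaces.Torus.IsClassicalNSSolutionOn (Set.Icc 0 T) ν f u p ∧ Literature.Analysis.FunctionSpaces.Torus.IsSmoothSpaceTimeOn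 (Set.Icc 0 T) f) → T ≤ T₀ → 2 * Literature.Analysis.FunctionSpaces.Torus.kineticEnergy (u 0) + Literature.Analysis.FunctionSpaces.Torus.gradNormSq (u 0) ≤ A → (∀ t ∈ Set.Icc 0 T, 2 * Literature.Analysis.FunctionSpaces.Torus.kineticEnergy (f t) + Literature.Analysis.FunctionSpaces.Torus.gradNormSq (f t) ≤ A) → ∀ t ∈ Set.Icc 0 T, 2 * Literature.Analysis.FunctionSpaces.Torus.kineticEnergy (u t) + Literature.Analysis.FunctionSpaces.Torus.gradNormSq (u t) ≤ M

/-- item stmt-NavierStokesRegularity-28103 · support · rank 9 · closed · proved by Summit.NavierStokesRegularity.NavierStokesRegularity.Theorems.ForcedAmplifierBridge.bridge_holds (planner) · by planner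
sources: FeffermanClay2006, arXiv:1108.1165
[support] IN CONE (binder hB of `closes`) · tag COSTUME(cite: board translation 𝕋³ ↔ ℝ³-periodic) ·
PROVED IN LENS (`ForcedAmplifierBridge.bridge_holds`, critic rows 251/252; writer lands the def-free
port as Theorems/ForcedAmplifierBridge.lean, FIRST LANDING). For every ν > 0, a failure of SFR ν
yields the ν-slice of D♯: lift u₀ and f to ℤ³-periodic fields on ℝ³ (`Torus.lift`), cut the force
off smoothly in time after the failing horizon T (χ_T = Real.smoothTransition (T+1−t); compact time
support ⟹ HasRapidTimeDecay), and descend any putative smooth solution with periodic u(t), p(t) to a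
classical torus solution on [0,T] (`IsClassicalNSSolutionOn.to_torus_holds`,
`Torus.lift_descend_holds`). [difficulty: provable-now] -/
@[route_item "route-NavierStokesRegularity-ForcedAmplifier", crux]
def Bridge : Prop :=
  ∀ ν : ℝ, 0 < ν → ¬ (∀ T : ℝ, 0 < T → ∀ u₀ : UnitAddTorus (Fin 3) → EuclideanSpace ℝ (Fin 3), Literature.Analysis.FunctionSpaces.Torus.IsSmooth u₀ → Literature.Analysis.FunctionSpaces.Torus.IsDivFree u₀ → ∀ f : ℝ → UnitAddTorus (Fin 3) → EuclideanSpace ℝ (Fin 3), Literature.Analysis.FunctionSpaces.Torus.IsSmoothSpaceTimeOn (Set.Ici 0) f → ∃ (u : ℝ → UnitAddTorus (Fin 3) → EuclideanSpace ℝ (Fin 3)) (p : ℝ → UnitAddTorus (Fin 3) → ℝ), Literature.Analysis.FunctionSpaces.Torus.IsClassicalNSSolutionOn (Set.Icc 0 T) ν f u p ∧ u 0 = u₀) → ∃ (u₀ : EuclideanSpace ℝ (Fin 3) → EuclideanSpace ℝ (Fin 3)) (f : ℝ → EuclideanSpace ℝ (Fin 3) → EuclideanSpace ℝ (Fin 3)),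 ContDiff ℝ (⊤ : ℕ∞) u₀ ∧ Literature.Analysis.FluidPDE.NSWave0.IsDivFree u₀ ∧ Literature.Analysis.FluidPDE.IsLatticePeriodic u₀ ∧ Literature.Analysis.FluidPDE.IsSmoothOnHalfSpace f ∧ (∀ t, 0 ≤ t → Literature.Analysis.FluidPDE.IsLatticePeriodic (f t)) ∧ Literature.Analysis.FluidPDE.HasRapidTimeDecay f ∧ ¬ ∃ (u : ℝ → EuclideanSpace ℝ (Fin 3) → EuclideanSpace ℝ (Fin 3)) (p : ℝ → EuclideanSpace ℝ (Fin 3) → ℝ), Literature.Analysis.FluidPDE.IsSmoothOnHalfSpace u ∧ Literature.Analysis.FluidPDE.IsSmoothOnHalfSpace p ∧ Literature.Analysis.FluidPDE.IsNavierStokesSolution ν f u₀ u p ∧ ∀ t, 0 ≤ t → Literature.Analysis.FluidPDE.IsLatticePeriodic (u t) ∧ Literature.Analysis.FluidPDE.IsLatticePeriodic (p t)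

-- `Bridge` holds: proved by `Summit.NavierStokesRegularity.NavierStokesRegularity.Theorems.ForcedAmplifierBridge.bridge_holds` (its module imports this route file, so no `_holds` link can be stated here).

/-- item stmt-NavierStokesRegularity-28105 · aside · rank 9 · closed · proved by Summit.NavierStokesRegularity.NavierStokesRegularity.Theorems.ForcedAmplifierExactness.exactness_holds (planner) · by planner
sources: arXiv:1108.1165, RobinsonRodrigoSadowskiCUP2016, ConstantinFoias1988
[support] ASIDE (certificate; not in cone) · tag COSTUME(cite) · PROVED IN LENS
(`ForcedAmplifierBridge.exactness_holds`). For every ν > 0 a D♯ datum refutes SFR ν: descend (U₀, F)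
to the torus; SFR gives classical solutions on every slab [0,T]; forward uniqueness patches them to
[0,∞) (`Torus.IsClassicalNSSolutionOn.exists_Ici_iff_forall_Icc`); the lift is a smooth solution on
ℝ³ × [0,∞) with periodic u and p — contradicting D♯. With Bridge: D♯ ⟺ ∀ ν > 0, ¬SFR ν (lens
`target_iff_not_smoothForcedRegular'`, unconditional). [difficulty: provable-now] -/
@[route_item "route-NavierStokesRegularity-ForcedAmplifier"]
def Exactness : Prop :=
  ∀ ν : ℝ, 0 < ν → (∃ (u₀ : EuclideanSpace ℝ (Fin 3) → EuclideanSpace ℝ (Fin 3)) (f : ℝ → EuclideanSpace ℝ (Fin 3) → EuclideanSpace ℝ (Fin 3)), ContDiff ℝ (⊤ : ℕ∞) u₀ ∧ Literature.Analysis.FluidPDE.NSWave0.IsDivFree u₀ ∧ Literature.Analysis.FluidPDE.IsLatticePeriodic u₀ ∧ Literature.Analysis.FluidPDE.IsSmoothOnHalfSpace f ∧ (∀ t, 0 ≤ t → Literature.Analysis.FluidPDE.IsLatticePeriodic (f t)) ∧ Literature.Analysis.FluidPDE.HasRapidTimeDecay f ∧ ¬ ∃ (u : ℝ → EuclideanSpace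 ℝ (Fin 3) → EuclideanSpace ℝ (Fin 3)) (p : ℝ → EuclideanSpace ℝ (Fin 3) → ℝ), Literature.Analysis.FluidPDE.IsSmoothOnHalfSpace u ∧ Literature.Analysis.FluidPDE.IsSmoothOnHalfSpace p ∧ Literature.Analysis.FluidPDE.IsNavierStokesSolution ν f u₀ u p ∧ ∀ t, 0 ≤ t → Literature.Analysis.FluidPDE.IsLatticePeriodic (u t) ∧ Literature.Analysis.FluidPDE.IsLatticePeriodic (p t)) → ¬ (∀ T : ℝ, 0 < T → ∀ u₀ : UnitAddTorus (Fin 3) → EuclideanSpace ℝ (Fin 3), Literature.Analysis.FunctionSpaces.Torus.IsSmooth u₀ → Literature.Analysis.FunctionSpaces.Torus.IsDivFree u₀ → ∀ f : ℝ → UnitAddTorus (Fin 3) → EuclideanSpace ℝ (Fin 3), Literature.Analysis.FunctionSpaces.Torus.IsSmoothSpaceTimeOn (Set.Ici 0) f → ∃ (u : ℝ → UnitAddTorus (Fin 3) → EuclideanSpace ℝ (Fin 3)) (p : ℝ → UnitAddTorus (Fin 3) → ℝ), Literature.Analysis.FunctionSpaces.Torus.IsClassicalNSSolutionOn (Set.Icc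 0 T) ν f u p ∧ u 0 = u₀)

-- `Exactness` holds: proved by `Summit.NavierStokesRegularity.NavierStokesRegularity.Theorems.ForcedAmplifierExactness.exactness_holds` (its module imports this route file, so no `_holds` link can be stated here).

/-- item stmt-NavierStokesRegularity-28106 · aside · rank 9 · closed · proved by Summit.NavierStokesRegularity.NavierStokesRegularity.Theorems.ForcedAmplifierBlowupAlternative.blowupAlternative_proof (planner) · by planner
sources: ConstantinFoias1988, arXiv:1108.1165, RobinsonRodrigoSadowskiCUP2016
[support] ASIDE (exactness certificate making AMP's WEAKER tag unconditional; not in cone) · tag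
COSTUME(cite: forced H¹ blow-up alternative, Constantin–Foias Ch. 10; Tao 2013 Thm 5.1/Lem 5.2) ·
leaf ATTACKABLE after ONE missing tree theorem (NODE-g25 §1: the time-dependent-force twin of
`Torus.classicalNS_forced_continuation_of_gradNormSq_le` — a classical solution of NS_ν(f), f
jointly smooth, on [0,T) with ‖u(t)‖_H¹ ≤ E₁ continues past T; size L). For every ν > 0, ¬SFR ν ⟹
Amplification ν: the maximal solution from the failing datum has unbounded H¹ norm before T, and its
restrictions to [0,Tₙ], Tₙ ↑ T*, are episodes of one data size with unbounded peaks. [difficulty: L] -/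
@[route_item "route-NavierStokesRegularity-ForcedAmplifier"]
def BlowupAlternative : Prop :=
  ∀ ν : ℝ, 0 < ν → ¬ (∀ T : ℝ, 0 < T → ∀ u₀ : UnitAddTorus (Fin 3) → EuclideanSpace ℝ (Fin 3), Literature.Analysis.FunctionSpaces.Torus.IsSmooth u₀ → Literature.Analysis.FunctionSpaces.Torus.IsDivFree u₀ → ∀ f : ℝ → UnitAddTorus (Fin 3) → EuclideanSpace ℝ (Fin 3), Literature.Analysis.FunctionSpaces.Torus.IsSmoothSpaceTimeOn (Set.Ici 0) f → ∃ (u : ℝ → UnitAddTorus (Fin 3) → EuclideanSpace ℝ (Fin 3)) (p : ℝ → UnitAddTorus (Fin 3) → ℝ), Literature.Analysis.FunctionSpaces.Torus.IsClassicalNSSolutionOn (Set.Icc 0 T) ν f u p ∧ u 0 = u₀) → ∃ A T₀ : ℝ, ∀ M : ℝ, ∃ (T : ℝ) (f u : ℝ → UnitAddTorus (Fin 3) → EuclideanSpace ℝ (Fin 3)) (p : ℝ → UnitAddTorus (Fin 3) → ℝ), (0 < T ∧ Literature.Analysis.FunctionSpaces.Torus.IsClassicalNSSolutionOn (Set.Icc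 0 T) ν f u p ∧ Literature.Analysis.FunctionSpaces.Torus.IsSmoothSpaceTimeOn (Set.Icc 0 T) f) ∧ T ≤ T₀ ∧ 2 * Literature.Analysis.FunctionSpaces.Torus.kineticEnergy (u 0) + Literature.Analysis.FunctionSpaces.Torus.gradNormSq (u 0) ≤ A ∧ (∀ t ∈ Set.Icc 0 T, 2 * Literature.Analysis.FunctionSpaces.Torus.kineticEnergy (f t) + Literature.Analysis.FunctionSpaces.Torus.gradNormSq (f t) ≤ A) ∧ ∃ t ∈ Set.Icc 0 T, M < 2 * Literature.Analysis.FunctionSpaces.Torus.kineticEnergy (u t) + Literature.Analysis.FunctionSpaces.Torus.gradNormSq (u t)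

-- `BlowupAlternative` holds: proved by `Summit.NavierStokesRegularity.NavierStokesRegularity.Theorems.ForcedAmplifierBlowupAlternative.blowupAlternative_proof` (its module imports this route file, so no `_holds` link can be stated here).

/-- item stmt-NavierStokesRegularity-28107 · aside · rank 9 · closed · proved by Summit.NavierStokesRegularity.NavierStokesRegularity.Theorems.ForcedAmplifierViscosityNormalisation.viscosityNormalisation_holds (planner) · by planner
sources: arXiv:1108.1165
[support] ASIDE (not in cone) · tag COSTUME(cite: scaling, Tao 2013 Rem. 1.11) · PROVED IN LENS
(`ForcedAmplifierBridge.viscosityNormalisation_holds`: (u,p,f)(t,x) ↦ (ν u(νt,x), ν² p(νt,x), ν²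
f(νt,x)) at fixed period via `Torus.IsClassicalNSSolutionOn.rescale_translate`; sizes ×ν² / ×ν⁴,
horizon ÷ν). Amplification at unit viscosity implies AMP — the residual may be read AT ν = 1 (lens
`closes_unitViscosity'`). [difficulty: provable-now] -/
@[route_item "route-NavierStokesRegularity-ForcedAmplifier"]
def ViscosityNormalisation : Prop :=
  (∃ A T₀ : ℝ, ∀ M : ℝ, ∃ (T : ℝ) (f u : ℝ → UnitAddTorus (Fin 3) → EuclideanSpace ℝ (Fin 3)) (p : ℝ → UnitAddTorus (Fin 3) → ℝ), (0 < T ∧ Literature.Analysis.FunctionSpaces.Torus.IsClassicalNSSolutionOn (Set.Icc 0 T) 1 f u p ∧ Literature.Analysis.FunctionSpaces.Torus.IsSmoothSpaceTimeOn (Set.Icc 0 T) f) ∧ T ≤ T₀ ∧ 2 * Literature.Analysis.FunctionSpaces.Torus.kineticEnergy (u 0) + Literature.Analysis.FunctionSpaces.Torus.gradNormSq (u 0) ≤ A ∧ (∀ t ∈ Set.Icc 0 T, 2 * Literature.Analysis.FunctionSpaces.Torus.kineticEnergy (f t) + Literature.Analysis.FunctionSpaces.Torus.gradNormSq (f t)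 ≤ A) ∧ ∃ t ∈ Set.Icc 0 T, M < 2 * Literature.Analysis.FunctionSpaces.Torus.kineticEnergy (u t) + Literature.Analysis.FunctionSpaces.Torus.gradNormSq (u t)) → ∀ ν : ℝ, 0 < ν → ∃ A T₀ : ℝ, ∀ M : ℝ, ∃ (T : ℝ) (f u : ℝ → UnitAddTorus (Fin 3) → EuclideanSpace ℝ (Fin 3)) (p : ℝ → UnitAddTorus (Fin 3) → ℝ), (0 < T ∧ Literature.Analysis.FunctionSpaces.Torus.IsClassicalNSSolutionOn (Set.Icc 0 T) ν f u p ∧ Literature.Analysis.FunctionSpaces.Torus.IsSmoothSpaceTimeOn (Set.Icc 0 T) f) ∧ T ≤ T₀ ∧ 2 * Literature.Analysis.FunctionSpaces.Torus.kineticEnergy (u 0) + Literature.Analysis.FunctionSpaces.Torus.gradNormSq (u 0) ≤ A ∧ (∀ t ∈ Set.Icc 0 T, 2 * Literature.Analysis.FunctionSpaces.Torus.kineticEnergy (f t) + Literature.Analysis.FunctionSpaces.Torus.gradNormSq (f t) ≤ A) ∧ ∃ t ∈ Set.Icc 0 T, M < 2 * Literature.Analysis.FunctionSpaces.Torus.kineticEnergy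 (u t) + Literature.Analysis.FunctionSpaces.Torus.gradNormSq (u t)

-- `ViscosityNormalisation` holds: proved by `Summit.NavierStokesRegularity.NavierStokesRegularity.Theorems.ForcedAmplifierViscosityNormalisation.viscosityNormalisation_holds` (its module imports this route file, so no `_holds` link can be stated here).

/-- item stmt-NavierStokesRegularity-28108 · aside · rank 9 · open · by planner
sources: arXiv:0710.1604, arXiv:1108.1165
[support] ASIDE — the BC5 WITNESS OF WEAKNESS for QuantitativeGap (not in cone) · tag COSTUME(cite:
KNOWN THEOREM, Tao 2009 arXiv:0710.1604 Thm 1.4 (i)⟺(iii); Tao 2013 Thm 1.20(i),(ii) at f ≡ 0) ·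
leaf ATTACKABLE (formalise-by-citation). In the UNFORCED model the door is decided: qualitative
periodic regularity (Conj 1.6 torus form at ν) implies the a-priori homogeneous H¹ bound (Conj 1.16
at ν) — while the summit analogue there, Clay (B), is open. Differs from QuantitativeGap in exactly
one clause: the weak-* limit FORCE is not smooth. [difficulty: M] -/
@[route_item "route-NavierStokesRegularity-ForcedAmplifier"]
def QuantitativeGapHomogeneous : Prop :=
  ∀ ν : ℝ, 0 < ν → (∀ T : ℝ, 0 < T → ∀ u₀ : UnitAddTorus (Fin 3) → EuclideanSpace ℝ (Fin 3), Literature.Analysis.FunctionSpaces.Torus.IsSmooth u₀ → Literature.Analysis.FunctionSpaces.Torus.IsDivFree u₀ → ∃ (u : ℝ → UnitAddTorus (Fin 3) → EuclideanSpace ℝ (Fin 3)) (p : ℝ → UnitAddTorus (Fin 3) → ℝ), Literature.Analysis.FunctionSpaces.Torus.IsClassicalNSSolutionOn (Set.Icc 0 T) ν 0 u p ∧ u 0 = u₀) → ∀ A T₀ : ℝ, ∃ M : ℝ, ∀ (T : ℝ) (u : ℝ → UnitAddTorus (Fin 3) → EuclideanSpace ℝ (Fin 3)) (p : ℝ → UnitAddTorus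 (Fin 3) → ℝ), (0 < T ∧ Literature.Analysis.FunctionSpaces.Torus.IsClassicalNSSolutionOn (Set.Icc 0 T) ν (0 : ℝ → UnitAddTorus (Fin 3) → EuclideanSpace ℝ (Fin 3)) u p ∧ Literature.Analysis.FunctionSpaces.Torus.IsSmoothSpaceTimeOn (Set.Icc 0 T) (0 : ℝ → UnitAddTorus (Fin 3) → EuclideanSpace ℝ (Fin 3))) → T ≤ T₀ → 2 * Literature.Analysis.FunctionSpaces.Torus.kineticEnergy (u 0) + Literature.Analysis.FunctionSpaces.Torus.gradNormSq (u 0) ≤ A → ∀ t ∈ Set.Icc 0 T, 2 * Literature.Analysis.FunctionSpaces.Torus.kineticEnergy (u t) + Literature.Analysis.FunctionSpaces.Torus.gradNormSq (u t) ≤ M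

/-- item stmt-NavierStokesRegularity-28104 · assembly · rank 1 · closed · proved by Summit.NavierStokesRegularity.NavierStokesRegularity.Theorems.ForcedAmplifierAssembly.assembly_holds (planner) · by planner
sources: arXiv:1108.1165, FeffermanClay2006
[assembly] AMP → QuantitativeGap → Bridge → Clay (D), erratum reading
(`NavierStokesBreakdownPeriodicPressurePeriodic`). -/
@[route_item "route-NavierStokesRegularity-ForcedAmplifier"]
def Assembly : Prop :=
  AMP → QuantitativeGap → Bridge → Summit.NavierStokesRegularity.NavierStokesRegularity.NavierStokesBreakdownPeriodicPressurePeriodic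

-- `Assembly` holds: proved by `Summit.NavierStokesRegularity.NavierStokesRegularity.Theorems.ForcedAmplifierAssembly.assembly_holds` (its module imports this route file, so no `_holds` link can be stated here).

/-! D-0027 §2.1 — DECIDING THEOREM (planner-authored via `route open/edit --closes-file`; by planner-decomp-ns-writer-1-g8-0 2026-08-30T19:42:39Z):
its hypotheses are this route's items and its conclusion the registered leaf `Summit.NavierStokesRegularity.NavierStokesRegularity.NavierStokesBreakdownPeriodicPressurePeriodic` (board rule D-0052) (glue_lint), and it elaborates with this file. -/

/-! D-0027 §2.1 — DECIDING THEOREM for route `ForcedAmplifier` (closes_target D-errata): the hypotheses are the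
route's items AMP (crux r2, declared residual), QuantitativeGap (crux r3), Bridge (support r9, proved in lens), and the
conclusion is the erratum leaf of Clay (D) BY NAME. Pure logic. -/
@[closes "route-NavierStokesRegularity-ForcedAmplifier"] theorem closes (hAMP : AMP) (hQ : QuantitativeGap) (hB : Bridge) :
    Summit.NavierStokesRegularity.NavierStokesRegularity.NavierStokesBreakdownPeriodicPressurePeriodic := by
  intro ν hν
  apply hB ν hν
  intro hS
  obtain ⟨A, T₀, hA⟩ := hAMP ν hν
  obtain ⟨M, hM⟩ := hQ ν hν hS A T₀
  obtain ⟨T, f, u, p, hE, hT, h0, hf, t, ht, hlt⟩ := hA M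
  exact absurd (hM T f u p hE hT h0 hf t ht) (not_le.2 hlt)

end Summit.NavierStokesRegularity.NavierStokesRegularity.Theses.ForcedAmplifier
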